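import Summits.AtomisticToContinuum.Crystallization.Theorems.ThreeConeCertificateSlackRigidityPricedFloorsUnique1
import HarnessLib

/-!
# `SlackRigidity` (stmt-AtomisticToContinuum-11960), line `priced-floors-palm-exactification`, stub S3
# (`stub_layeredMeanSelection`), package (U) "uniqueness of the layer system", part 2: the dichotomy
# and the data of a layer system

Lead c19, worker W12.  Two registered sub-goals of the U-package:

* `lms_layer_dichotomy` (U1) — two normal-form data `e, e'` fitting the same set `S` have the same
  layers up to the orientation `m ↦ −m`, or both are ideal fcc data.  CASE A: the in-plane generators
  `T' u', T' v'` of `e'` are orthogonal to the normal `n` of `e`; then `n' = ±n` (part 1) and the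
  layers, being plane sections, agree up to orientation.  CASE B: one of them is off the layer plane
  of `e`; since `S` is invariant under the in-plane lattice translations of `e'`, every site of `S`
  carries the planar hexagon `{±T'u', ±T'v', ±T'(u' − v')}` with a vertex off the plane, and the
  hexagon step (part 1, from `globalize_pattern_hexagon`) at every layer gives `IsFccData e` (and
  `a' = a`); by symmetry also `IsFccData e'` (`trichotomy`);
* `lms_data_of_layers` (U2) — data with the same layers have the same spacing (shortest vectors of
  layer `0`), the same heights (same normal, plane sections) and the same word up to a global sign:
  the switch set `{m | s (m+1) ≠ s m}` is read off from the layers alone, because `s (m+1) = s m` iff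
  layer `2` of the data re-rooted at layer `m` is in hole registry, i.e. has three transport targets
  (`card_layerTargets`, `layerTargets_eq_of_layerOf_eq`), and two `±1` words with the same switch set
  agree up to sign (`word_eq_or_eq_neg`).

All `[folklore]`.
-/

noncomputable section

open Set
open scoped BigOperators

namespace Summit.AtomisticToContinuum.Crystallization.Theorems.SlackRigidityPricedFloorsUnique

open Literature.MathematicalPhysics.StatisticalMechanics
open Summit.AtomisticToContinuum.Crystallization.Theorems.SlackRigidityPricedFloors
open Summit.AtomisticToContinuum.Crystallization.Theorems.SlackRigidityPricedFloorsTransport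
open Summit.AtomisticToContinuum.Crystallization.Theorems.SlackRigidityPricedFloorsGlobalize
open Summit.AtomisticToContinuum.Crystallization.Theorems.LayeredHull

/-! ## (U1) The dichotomy -/

/-- **An off-plane hexagon vector of other fitting data forces ideal fcc data** (and equal
spacings). [folklore] -/
theorem fcc_of_offplane {S : Set E3} {e e' : LData} (he : Fits S e) (he' : Fits S e')
    (h : inner ℝ (e.1 (layerNormal 1)) (e'.1 (triangularVec₁ e'.2.1)) ≠ 0 ∨
      inner ℝ (e.1 (layerNormal 1)) (e'.1 (triangularVec₂ e'.2.1)) ≠ 0) :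
    IsFccData e ∧ e'.2.1 = e.2.1 := by
  set U := e'.1 (triangularVec₁ e'.2.1) with hU
  set V := e'.1 (triangularVec₂ e'.2.1) with hV
  have ha' := spacing_pos he'.1
  obtain ⟨nU, nV, nUV⟩ := norm_hexagon ha'.le
  rw [← he'.1.1] at nU nV nUV
  rw [map_sub] at nUV
  have nVU : ‖V - U‖ = e'.2.1 := by rw [← norm_neg, neg_sub]; exact nUV
  have hle : e'.2.1 ≤ 28 / 25 := by linarith [he'.1.2.1.2.1]
  have hcl : ∀ y ∈ S, ∀ p q : ℤ, y + ((p : ℝ) • U + (q : ℝ) • V) ∈ S :=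
    fun y hy p q => add_mem_of_fits he' hy p q
  -- the conclusion of one hexagon step, for either choice of the off-plane vector
  have step : ∀ m : ℤ, e.2.2.1 (m - 1) = e.2.2.1 m ∧
      e.2.2.2 (m - 1) - e.2.2.2 m = -(e.2.2.2 (m + 1) - e.2.2.2 m) ∧
      (e.2.2.2 (m + 1) - e.2.2.2 m) ^ 2 = 2 * e.2.1 ^ 2 / 3 ∧ e'.2.1 = e.2.1 := by
    intro m
    rcases h with h | h
    · -- η = U, ξ = V
      have hS : ∀ y ∈ S, y + V ∈ S ∧ y - V ∈ S ∧ y + (V - U) ∈ S ∧ y + (U - V) ∈ S ∧ y - U ∈ S := by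
        intro y hy
        refine ⟨by simpa using hcl y hy 0 1, by simpa [sub_eq_add_neg] using hcl y hy 0 (-1),
          ?_, ?_, by simpa [sub_eq_add_neg] using hcl y hy (-1) 0⟩
        · convert hcl y hy (-1) 1 using 2; simp [sub_eq_neg_add]
        · convert hcl y hy 1 (-1) using 2; simp [sub_eq_add_neg]
      obtain ⟨k1, k2, k3, k4⟩ := hexagon_step he (η := U) (ξ := V) (by rw [nU, nV]) (by rw [nUV, nU])
        (by rw [nU]; exact ha') (by rw [nU]; exact hle) hS h m
      exact ⟨k1, k2, k3, by rw [← k4, nU]⟩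
    · -- η = V, ξ = U
      have hS : ∀ y ∈ S, y + U ∈ S ∧ y - U ∈ S ∧ y + (U - V) ∈ S ∧ y + (V - U) ∈ S ∧ y - V ∈ S := by
        intro y hy
        refine ⟨by simpa using hcl y hy 1 0, by simpa [sub_eq_add_neg] using hcl y hy (-1) 0,
          ?_, ?_, by simpa [sub_eq_add_neg] using hcl y hy 0 (-1)⟩
        · convert hcl y hy 1 (-1) using 2; simp [sub_eq_add_neg]
        · convert hcl y hy (-1) 1 using 2; simp [sub_eq_neg_add]
      obtain ⟨k1, k2, k3, k4⟩ := hexagon_step he (η := V) (ξ := U) (by rw [nU, nV]) (by rw [nVU, nV])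
        (by rw [nV]; exact ha') (by rw [nV]; exact hle) hS h m
      exact ⟨k1, k2, k3, by rw [← k4, nV]⟩
  refine ⟨⟨fun m => ?_, fun m => ?_⟩, (step 0).2.2.2⟩
  · have := (step (m + 1)).1
    rw [add_sub_cancel_right] at this
    exact this.symm
  · obtain ⟨-, -, hq, -⟩ := step m
    have hpos : 0 < e.2.2.2 (m + 1) - e.2.2.2 m := by
      have := (he.1.2.1.2.2.2 m).1
      have ha := spacing_pos he.1
      linarith
    have ha := spacing_pos he.1
    have hsq : (e.2.1 * Real.sqrt (2 / 3)) ^ 2 = 2 * e.2.1 ^ 2 / 3 := by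
      rw [mul_pow, Real.sq_sqrt (by norm_num)]; ring
    have hnn : 0 ≤ e.2.1 * Real.sqrt (2 / 3) := by positivity
    nlinarith [hq, hsq, hpos, hnn, sq_nonneg (e.2.2.2 (m + 1) - e.2.2.2 m - e.2.1 * Real.sqrt (2 / 3)),
      sq_nonneg (e.2.2.2 (m + 1) - e.2.2.2 m + e.2.1 * Real.sqrt (2 / 3))]

/-- **Trichotomy of two fitting data**: same layers, or reversed layers, or both ideal fcc with the
same spacing. [folklore] -/
theorem trichotomy {S : Set E3} {e e' : LData} (he : Fits S e) (he' : Fits S e') :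
    (∀ m : ℤ, layerOf e' m = layerOf e m) ∨ (∀ m : ℤ, layerOf e' m = layerOf e (-m)) ∨
      (IsFccData e ∧ IsFccData e' ∧ e'.2.1 = e.2.1) := by
  by_cases hA : inner ℝ (e.1 (layerNormal 1)) (e'.1 (triangularVec₁ e'.2.1)) = 0 ∧
      inner ℝ (e.1 (layerNormal 1)) (e'.1 (triangularVec₂ e'.2.1)) = 0
  · rcases normal_eq_or_eq_neg he.1 he'.1 hA.1 hA.2 with h | h
    · exact Or.inl (layerOf_eq_of_normal_eq he he' h)
    · exact Or.inr (Or.inl (layerOf_eq_of_normal_eq_neg he he' h))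
  · right; right
    obtain ⟨hfcc, ha⟩ := fcc_of_offplane he he' (not_and_or.1 hA)
    refine ⟨hfcc, ?_, ha⟩
    by_cases hA' : inner ℝ (e'.1 (layerNormal 1)) (e.1 (triangularVec₁ e.2.1)) = 0 ∧
        inner ℝ (e'.1 (layerNormal 1)) (e.1 (triangularVec₂ e.2.1)) = 0
    · exfalso
      apply hA
      have h0 := inner_normal_generators he'.1
      rcases normal_eq_or_eq_neg he'.1 he.1 hA'.1 hA'.2 with h | h
      · rw [h]; exact h0
      · rw [h, inner_neg_left, inner_neg_left, neg_eq_zero, neg_eq_zero]; exact h0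
    · exact (fcc_of_offplane he' he (not_and_or.1 hA')).1

/-- **(U1) Dichotomy of the layer system (registered sub-goal `lms_layer_dichotomy`)**: two
normal-form data fitting the same set have the same layers up to orientation, unless both are ideal
fcc data. [folklore] -/
theorem lms_layer_dichotomy : ∀ (S : Set E3) (e e' : LData), Fits S e → Fits S e' → ((∀ m : ℤ, layerOf e' m = layerOf e m) ∨ (∀ m : ℤ, layerOf e' m = layerOf e (-m))) ∨ (IsFccData e ∧ IsFccData e') := by
  intro S e e' he he'
  rcases trichotomy he he' with h | h | ⟨h1, h2, -⟩
  · exact Or.inl (Or.inl h)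
  · exact Or.inl (Or.inr h)
  · exact Or.inr ⟨h1, h2⟩

/-! ## (U2) The data of a layer system -/

/-- **Same layers ⇒ same normal.** [folklore] -/
theorem normal_eq_of_layerOf_eq {S : Set E3} {e e' : LData} (he : Fits S e) (he' : Fits S e')
    (h : ∀ m : ℤ, layerOf e' m = layerOf e m) : e'.1 (layerNormal 1) = e.1 (layerNormal 1) := by
  obtain ⟨gu, gv⟩ := pointOf_generators he'.1
  have hu : inner ℝ (e.1 (layerNormal 1)) (e'.1 (triangularVec₁ e'.2.1)) = 0 := by
    have hm : pointOf e' 0 1 0 ∈ layerOf e 0 := h 0 ▸ pointOf_mem_layerOf e' 0 1 0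
    rw [← gu, ((mem_layerOf_iff_inner he 0 _).1 hm).2, he.1.2.2]
  have hv : inner ℝ (e.1 (layerNormal 1)) (e'.1 (triangularVec₂ e'.2.1)) = 0 := by
    have hm : pointOf e' 0 0 1 ∈ layerOf e 0 := h 0 ▸ pointOf_mem_layerOf e' 0 0 1
    rw [← gv, ((mem_layerOf_iff_inner he 0 _).1 hm).2, he.1.2.2]
  rcases normal_eq_or_eq_neg he.1 he'.1 hu hv with hn | hn
  · exact hn
  · exfalso
    -- layer `1` of `e'` is layer `1` of `e`: its normal coordinate is `z 1 > 0` and `-z' 1 < 0`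
    have hm : pointOf e' 1 0 0 ∈ layerOf e 1 := h 1 ▸ pointOf_mem_layerOf e' 1 0 0
    have h1 := ((mem_layerOf_iff_inner he 1 _).1 hm).2
    have h2 := inner_normal_pointOf he'.1 1 0 0
    rw [hn, inner_neg_left] at h2
    have hz := strictMono_height he.1 (show (0 : ℤ) < 1 by norm_num)
    have hz' := strictMono_height he'.1 (show (0 : ℤ) < 1 by norm_num)
    rw [he.1.2.2] at hz
    rw [he'.1.2.2] at hz'
    linarith

/-- **Same layers ⇒ same heights.** [folklore] -/
theorem heights_eq_of_layerOf_eq {S : Set E3} {e e' : LData} (he : Fits S e) (he' : Fits S e')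
    (h : ∀ m : ℤ, layerOf e' m = layerOf e m) : e'.2.2.2 = e.2.2.2 :=
  funext fun m => heights_eq_of_normal_eq he he' (normal_eq_of_layerOf_eq he he' h) m

/-- In layer `0` of normal data every nonzero point has norm `≥ a`, and `T u` has norm `a`. [folklore] -/
theorem spacing_le_norm_of_mem_layerOf_zero {e : LData} (he : IsNormalData e) {p : E3}
    (hp : p ∈ layerOf e 0) (hp0 : p ≠ 0) : e.2.1 ≤ ‖p‖ := by
  obtain ⟨i, j, rfl⟩ := hp
  rw [norm_pointOf he, he.2.2, haggLabel_zero]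
  have hij : ((i, j) : ℤ × ℤ) ≠ 0 := by
    rintro hij
    simp only [Prod.mk_eq_zero] at hij
    obtain ⟨rfl, rfl⟩ := hij
    exact hp0 (pointOf_zero e he.2.2)
  exact cake_le_norm_layerVec_inLayer e.2.1 (spacing_pos he).le hij

/-- **Same layer `0` ⇒ same spacing.** [folklore] -/
theorem spacing_eq_of_layerOf_zero_eq {e e' : LData} (he : IsNormalData e) (he' : IsNormalData e')
    (h : layerOf e' 0 = layerOf e 0) : e'.2.1 = e.2.1 := by
  have key : ∀ {e e' : LData}, IsNormalData e → IsNormalData e' → layerOf e' 0 = layerOf e 0 →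
      e.2.1 ≤ e'.2.1 := by
    intro e e' he he' h
    have ha' := spacing_pos he'
    obtain ⟨gu, -⟩ := pointOf_generators he'
    have hn : ‖pointOf e' 0 1 0‖ = e'.2.1 := by rw [gu, he'.1, (norm_hexagon ha'.le).1]
    have hm : pointOf e' 0 1 0 ∈ layerOf e 0 := h ▸ pointOf_mem_layerOf e' 0 1 0
    have h0 : pointOf e' 0 1 0 ≠ 0 := by
      intro h0; rw [h0, norm_zero] at hn; linarith
    rw [← hn]
    exact spacing_le_norm_of_mem_layerOf_zero he hm h0
  exact le_antisymm (key he' he h.symm) (key he he' h)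

/-- **Same layers ⇒ the re-rooted data have the same layers.** [folklore] -/
theorem layerOf_rerootData_eq {e e' : LData} (h : ∀ m : ℤ, layerOf e' m = layerOf e m) (m k : ℤ) :
    layerOf (rerootData e' m) k = layerOf (rerootData e m) k := by
  have hm : pointOf e' m 0 0 ∈ layerOf e m := h m ▸ pointOf_mem_layerOf e' m 0 0
  obtain ⟨i₀, j₀, hij⟩ := hm
  rw [layerOf_rerootData e' m k 0 0, layerOf_rerootData e m k i₀ j₀, hij, h (k + m)]

/-- **Word switches are seen in the layers**: `s (m+1) = s m` iff layer `2` of the data re-rooted at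
layer `m` is in hole registry (three targets), a property of the layers as sets. [folklore] -/
theorem step_iff_of_layerOf_eq {S : Set E3} {e e' : LData} (he : Fits S e) (he' : Fits S e')
    (h : ∀ m : ℤ, layerOf e' m = layerOf e m) (m : ℤ) :
    (e.2.2.1 (m + 1) = e.2.2.1 m ↔ e'.2.2.1 (m + 1) = e'.2.2.1 m) := by
  have hc := congrArg Finset.card (layerTargets_eq_of_layerOf_eq (isNormalData_rerootData he.1 m)
    (isNormalData_rerootData he'.1 m) (layerOf_rerootData_eq h m 2))
  rw [card_layerTargets (isNormalData_rerootData he'.1 m), card_layerTargets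
    (isNormalData_rerootData he.1 m)] at hc
  have hL : ∀ e : LData, haggLabel (rerootData e m).2.2.1 2 = e.2.2.1 m + e.2.2.1 (m + 1) := by
    intro e
    show haggLabel (fun k => e.2.2.1 (k + m)) 2 = _
    rw [ext_haggLabel_shift, show (2 : ℤ) + m = m + 1 + 1 by ring, haggLabel_succ, haggLabel_succ]
    ring
  rw [hL, hL] at hc
  have hs := he.1.2.1.2.2.1
  have hs' := he'.1.2.1.2.2.1
  rcases hs m with h1 | h1 <;> rcases hs (m + 1) with h2 | h2 <;> rcases hs' m with h3 | h3 <;>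
    rcases hs' (m + 1) with h4 | h4 <;> simp [h1, h2, h3, h4] at hc ⊢

/-- **Two `±1` words with the same switch set agree up to a global sign.** [folklore] -/
theorem word_eq_or_eq_neg {s s' : ℤ → ℤ} (hs : IsHaggSeq s) (hs' : IsHaggSeq s')
    (h : ∀ m : ℤ, s (m + 1) = s m ↔ s' (m + 1) = s' m) : s' = s ∨ s' = fun m => -s m := by
  have h0 : s' 0 = s 0 ∨ s' 0 = -s 0 := by
    rcases hs 0 with h1 | h1 <;> rcases hs' 0 with h2 | h2 <;> simp [h1, h2]
  rcases h0 with h0 | h0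
  · left
    funext m
    induction m using Int.induction_on with
    | zero => exact h0
    | succ n ih =>
      have := h n
      rcases hs n with h1 | h1 <;> rcases hs (n + 1) with h2 | h2 <;> rcases hs' n with h3 | h3 <;>
        rcases hs' (n + 1) with h4 | h4 <;> omega
    | pred n ih =>
      have := h (-n - 1)
      rw [sub_add_cancel] at this
      rcases hs (-n) with h1 | h1 <;> rcases hs (-n - 1) with h2 | h2 <;> rcases hs' (-n) with h3 | h3 <;>
        rcases hs' (-n - 1) with h4 | h4 <;> omega
  · right
    funext m
    induction m using Int.induction_on with
    | zero => exact h0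
    | succ n ih =>
      have := h n
      rcases hs n with h1 | h1 <;> rcases hs (n + 1) with h2 | h2 <;> rcases hs' n with h3 | h3 <;>
        rcases hs' (n + 1) with h4 | h4 <;> omega
    | pred n ih =>
      have := h (-n - 1)
      rw [sub_add_cancel] at this
      rcases hs (-n) with h1 | h1 <;> rcases hs (-n - 1) with h2 | h2 <;> rcases hs' (-n) with h3 | h3 <;>
        rcases hs' (-n - 1) with h4 | h4 <;> omega

/-- **(U2) The data are determined by the layers (registered sub-goal `lms_data_of_layers`)**: two
normal-form data fitting the same set with the same layers have the same spacing and heights, and the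
same word up to a global sign. [folklore] -/
theorem lms_data_of_layers : ∀ (S : Set E3) (e e' : LData), Fits S e → Fits S e' → (∀ m : ℤ, layerOf e' m = layerOf e m) → e'.2.1 = e.2.1 ∧ e'.2.2.2 = e.2.2.2 ∧ (e'.2.2.1 = e.2.2.1 ∨ e'.2.2.1 = fun m => -e.2.2.1 m) := by
  intro S e e' he he' h
  exact ⟨spacing_eq_of_layerOf_zero_eq he.1 he'.1 (h 0), heights_eq_of_layerOf_eq he he' h,
    word_eq_or_eq_neg he.1.2.1.2.2.1 he'.1.2.1.2.2.1 (step_iff_of_layerOf_eq he he' h)⟩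

end Summit.AtomisticToContinuum.Crystallization.Theorems.SlackRigidityPricedFloorsUnique

end
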